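import Mathlib
import Summits.Parity.BatemanHorn.Theorems.IsogenyRedeiSplitBlockJacobiPureDigitPiecesBurgess
import HarnessLib

/-!
# Route `IsogenyRedei`, crux `SplitBlockJacobi` (stmt-Parity-11583), line `split-mass-middle-prime`:
# the pure digit pieces on the whole range `θ′ + η < 1` from Hypothesis C
# (stub `stub_digitPiecesOfHypothesisC`)

The registered stub `stub_digitPiecesOfHypothesisC` of the line skeleton (reshape r2) asks: *if*
**Hypothesis C** holds — for every `κ > 0` there are `δ > 0`, `c > 0` with
`|Σ_{M < n ≤ M+N} (n | p)| ≤ c N^{1−δ}` for all odd primes `p`, all `M` and all `N ≥ p^κ`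
(Friedlander–Iwaniec–Mazur–Rubin 2013, Conjecture `C_n` for all `n`; Burgess for `κ > 1/4`) —
*then* for all `1/2 < θ < θ′ < 1`, `0 < η`, `θ′ + η < 1` there is `δ > 0` with a power saving
`O(x^{1−δ})` in the `ℓ¹`-sum over `(Q, ν, k, a)` — primes `x^θ < Q ≤ x^{θ′}`, roots
`ν² ≡ −1 (mod Q)`, moduli `1 ≤ k ≤ x^η`, root classes `a mod k` — of the absolute digit-character
sums `Σ_{u : ν + Q(a+ku) ≤ x} ((ν²+1)/Q + 2ν(a+ku) | Q)` (the pure digit pieces,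
`PureDigitPiecesPow`).  This file proves that implication (`stub_digitPiecesOfHypothesisC`);
Hypothesis C itself is a conjecture-grade input of the line and enters only as the antecedent.

## Proof

* From Hypothesis C at `κ = (1 − θ′ − η)/(2θ′) > 0` get `δ₀ > 0`, `c > 0`; put `δ = min δ₀ 1`.
  For **all** `M, N` one has the Burgess-shaped bound
  `|Σ_{M<n≤M+N} (n | p)| ≤ max(c,1) · N^{1−δ} · p^{κδ} · (1 + log p)`
  (`intervalBound_of_hypothesisC`): if `N ≥ p^κ (≥ 1)` this is Hypothesis C and
  `N^{1−δ₀} ≤ N^{1−δ}`, `p^{κδ} (1 + log p) ≥ 1`; if `N < p^κ` it is the trivial bound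
  `|Σ| ≤ N = N^{1−δ} N^δ ≤ N^{1−δ} p^{κδ}` (`abs_sum_Ioc_jacobiSym_le`).
* This is the hypothesis of the tree's explicit majorant `burgess_sum_le_majorant` (file
  `IsogenyRedeiSplitBlockJacobiPureDigitPiecesBurgess`) with
  `s = 1 − δ`, `b = κδ`, whose exponents are `E₁ = θ′ + η + θ′κδ = θ′ + η + δ(1−θ′−η)/2 < 1` and
  `E₂ = s + θ′(1 + b − s) + η(1 − s) = 1 − δ(1−θ′−η)/2 < 1` (`θ′κ = (1−θ′−η)/2`); with
  `E = max(E₁, E₂) < 1` and the saving `(1 − E)/2` the three logarithms are absorbed by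
  `rpow_mul_one_add_log_pow_three_isBigO`, exactly as in `pureDigitPiecesPow_of_burgess_range`.

No new definitions; everything is proved (no named facts; Hypothesis C is a hypothesis).
-/

noncomputable section

open Filter Finset Asymptotics
open scoped Classical

open Literature.NumberTheory.Sieve.Iwaniec1978 (rho rho_le_two exists_sum_rho_le)

namespace Summit.Parity.BatemanHorn.Cruxes.SplitBlockJacobi.SplitMassMiddlePrime

/-! ### From Hypothesis C to a Burgess-shaped bound for all `M, N` -/

/-- **The trivial bound** `|Σ_{M < n ≤ M+N} (n | p)| ≤ N` (each Jacobi symbol is `0` or `±1`,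
`jacobiSym.trichotomy`). [folklore] -/
theorem abs_sum_Ioc_jacobiSym_le (p M N : ℕ) :
    |∑ n ∈ Finset.Ioc M (M + N), (jacobiSym (n : ℤ) p : ℝ)| ≤ N := by
  calc |∑ n ∈ Finset.Ioc M (M + N), (jacobiSym (n : ℤ) p : ℝ)|
      ≤ ∑ n ∈ Finset.Ioc M (M + N), |(jacobiSym (n : ℤ) p : ℝ)| := Finset.abs_sum_le_sum_abs _ _
    _ ≤ ∑ _n ∈ Finset.Ioc M (M + N), (1 : ℝ) := Finset.sum_le_sum fun n _ => by
        rcases jacobiSym.trichotomy (n : ℤ) p with h | h | h <;> simp [h]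
    _ = N := by simp

/-- **Hypothesis C in Burgess shape.** If `|Σ_{M<n≤M+N} (n | p)| ≤ c N^{1−δ₀}` whenever
`N ≥ p^κ` (`κ > 0`, `p` an odd prime), then for `0 < δ ≤ δ₀` and **all** `M, N`:
`|Σ_{M<n≤M+N} (n | p)| ≤ max(c,1) · N^{1−δ} · p^{κδ} · (1 + log p)`.  For `N ≥ p^κ ≥ 1` use the
hypothesis, `N^{1−δ₀} ≤ N^{1−δ}` and `p^{κδ} (1 + log p) ≥ 1`; for `N < p^κ` the trivial bound
`|Σ| ≤ N = N^{1−δ} N^δ ≤ N^{1−δ} p^{κδ}` (`abs_sum_Ioc_jacobiSym_le`). [folklore] -/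
theorem intervalBound_of_hypothesisC {κ δ₀ δ c : ℝ} (hκ : 0 < κ) (hδ : 0 < δ) (hδδ₀ : δ ≤ δ₀)
    (hH : ∀ p : ℕ, p.Prime → p ≠ 2 → ∀ M N : ℕ, (p : ℝ) ^ κ ≤ (N : ℝ) →
      |∑ n ∈ Finset.Ioc M (M + N), (jacobiSym (n : ℤ) p : ℝ)| ≤ c * (N : ℝ) ^ (1 - δ₀)) :
    ∀ p : ℕ, p.Prime → p ≠ 2 → ∀ M N : ℕ,
      |∑ n ∈ Finset.Ioc M (M + N), (jacobiSym (n : ℤ) p : ℝ)| ≤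
        max c 1 * (N : ℝ) ^ (1 - δ) * (p : ℝ) ^ (κ * δ) * (1 + Real.log p) := by
  intro p hp hp2 M N
  have hp1 : (1 : ℝ) ≤ p := by exact_mod_cast hp.one_lt.le
  have hp0 : (0 : ℝ) ≤ p := zero_le_one.trans hp1
  have hlog : 0 ≤ Real.log p := Real.log_nonneg hp1
  have hpκδ : 1 ≤ (p : ℝ) ^ (κ * δ) := Real.one_le_rpow hp1 (by positivity)
  have hc1 : 1 ≤ max c 1 := le_max_right _ _
  have hc0 : 0 ≤ max c 1 := zero_le_one.trans hc1
  have hN0 : (0 : ℝ) ≤ N := Nat.cast_nonneg _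
  suffices h : |∑ n ∈ Finset.Ioc M (M + N), (jacobiSym (n : ℤ) p : ℝ)| ≤
      max c 1 * (N : ℝ) ^ (1 - δ) * (p : ℝ) ^ (κ * δ) by
    calc |∑ n ∈ Finset.Ioc M (M + N), (jacobiSym (n : ℤ) p : ℝ)|
        ≤ max c 1 * (N : ℝ) ^ (1 - δ) * (p : ℝ) ^ (κ * δ) := h
      _ ≤ max c 1 * (N : ℝ) ^ (1 - δ) * (p : ℝ) ^ (κ * δ) * (1 + Real.log p) :=
          le_mul_of_one_le_right (by positivity) (by linarith)
  rcases le_or_gt ((p : ℝ) ^ κ) N with hle | hlt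
  · -- `N ≥ p^κ ≥ 1`: Hypothesis C
    have hN1 : (1 : ℝ) ≤ N := (Real.one_le_rpow hp1 hκ.le).trans hle
    calc |∑ n ∈ Finset.Ioc M (M + N), (jacobiSym (n : ℤ) p : ℝ)|
        ≤ c * (N : ℝ) ^ (1 - δ₀) := hH p hp hp2 M N hle
      _ ≤ max c 1 * (N : ℝ) ^ (1 - δ₀) :=
          mul_le_mul_of_nonneg_right (le_max_left _ _) (Real.rpow_nonneg hN0 _)
      _ ≤ max c 1 * (N : ℝ) ^ (1 - δ) :=
          mul_le_mul_of_nonneg_left (Real.rpow_le_rpow_of_exponent_le hN1 (by linarith)) hc0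
      _ ≤ max c 1 * (N : ℝ) ^ (1 - δ) * (p : ℝ) ^ (κ * δ) :=
          le_mul_of_one_le_right (by positivity) hpκδ
  · -- `N < p^κ`: the trivial bound
    have hsplit : (N : ℝ) = (N : ℝ) ^ (1 - δ) * (N : ℝ) ^ δ := by
      rw [← Real.rpow_add' hN0 (by norm_num), sub_add_cancel, Real.rpow_one]
    have hNδ : (N : ℝ) ^ δ ≤ (p : ℝ) ^ (κ * δ) := by
      rw [Real.rpow_mul hp0]
      exact Real.rpow_le_rpow hN0 hlt.le hδ.le
    calc |∑ n ∈ Finset.Ioc M (M + N), (jacobiSym (n : ℤ) p : ℝ)| ≤ N :=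
          abs_sum_Ioc_jacobiSym_le p M N
      _ = 1 * ((N : ℝ) ^ (1 - δ) * (N : ℝ) ^ δ) := by rw [one_mul]; exact hsplit
      _ ≤ max c 1 * ((N : ℝ) ^ (1 - δ) * (p : ℝ) ^ (κ * δ)) :=
          mul_le_mul hc1 (mul_le_mul_of_nonneg_left hNδ (Real.rpow_nonneg hN0 _))
            (by positivity) hc0
      _ = max c 1 * (N : ℝ) ^ (1 - δ) * (p : ℝ) ^ (κ * δ) := by ring

/-! ### The theorem: `HypothesisC → PureDigitPiecesPow` -/

/-- **Hypothesis C implies the pure digit pieces with a power saving on the whole range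
`θ′ + η < 1`.** Assume Hypothesis C (Friedlander–Iwaniec–Mazur–Rubin 2013, Conjecture `C_n` for
all `n`; an explicit hypothesis, conjecture-grade): for every `κ > 0` there are `δ > 0`, `c > 0`
with `|Σ_{M < n ≤ M+N} (n | p)| ≤ c N^{1−δ}` for all odd primes `p`, all `M`, all `N ≥ p^κ`.  Then
for `1/2 < θ < θ′ < 1`, `0 < η`, `θ′ + η < 1` there is `δ > 0` with
`Σ_{x^θ<Q≤x^{θ′} prime} Σ_{ν²≡−1 (Q), ν<Q} Σ_{1≤k≤x^η} Σ_{a<k, Qk ∣ (ν+Qa)²+1}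
   |Σ_{u ≤ x : ν + Q(a+ku) ≤ x} ((ν²+1)/Q + 2ν(a+ku) | Q)| = O(x^{1−δ})`.
Proof: at `κ = (1 − θ′ − η)/(2θ′)` Hypothesis C gives, for `δ = min(δ₀, 1)`, the Burgess-shaped
bound `max(c,1) N^{1−δ} p^{κδ} (1 + log p)` for all `M, N` (`intervalBound_of_hypothesisC`);
the majorant `burgess_sum_le_majorant` with `s = 1 − δ`, `b = κδ` is `O(x^E (1 + log x)³)`,
`E = max(θ′ + η + δ(1−θ′−η)/2, 1 − δ(1−θ′−η)/2) < 1`, and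
`x^E (1 + log x)³ = O(x^{1 − (1−E)/2})` (`rpow_mul_one_add_log_pow_three_isBigO`). [folklore] -/
theorem stub_digitPiecesOfHypothesisC :
    (∀ κ : ℝ, 0 < κ → ∃ δ : ℝ, 0 < δ ∧ ∃ c : ℝ, 0 < c ∧ ∀ p : ℕ, p.Prime → p ≠ 2 → ∀ M N : ℕ,
      (p : ℝ) ^ κ ≤ (N : ℝ) →
        |∑ n ∈ Finset.Ioc M (M + N), (jacobiSym (n : ℤ) p : ℝ)| ≤ c * (N : ℝ) ^ (1 - δ)) →
    ∀ θ θ' η : ℝ, 1 / 2 < θ → θ < θ' → θ' < 1 → 0 < η → θ' + η < 1 →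
      ∃ δ : ℝ, 0 < δ ∧
        (fun x : ℕ =>
          ∑ Q ∈ (Finset.range (x + 1)).filter
              (fun Q : ℕ => Q.Prime ∧ (x : ℝ) ^ θ < (Q : ℝ) ∧ (Q : ℝ) ≤ (x : ℝ) ^ θ'),
            ∑ ν ∈ (Finset.range Q).filter (fun ν : ℕ => Q ∣ ν ^ 2 + 1),
              ∑ k ∈ (Finset.Icc 1 x).filter (fun k : ℕ => (k : ℝ) ≤ (x : ℝ) ^ η),
                ∑ a ∈ (Finset.range k).filter (fun a : ℕ => Q * k ∣ (ν + Q * a) ^ 2 + 1),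
                  |∑ u ∈ (Finset.range (x + 1)).filter (fun u : ℕ => ν + Q * (a + k * u) ≤ x),
                      (jacobiSym (((ν ^ 2 + 1) / Q + 2 * ν * (a + k * u) : ℕ) : ℤ) Q : ℝ)|)
          =O[Filter.atTop] fun x : ℕ => (x : ℝ) ^ (1 - δ) := by
  intro hHyp θ θ' η hθ hθθ' _hθ'1 hη hsum
  have hθ'0 : 0 < θ' := by linarith
  have hgap : 0 < 1 - θ' - η := by linarith
  -- Hypothesis C at `κ = (1 - θ' - η) / (2θ')`
  obtain ⟨κ, hκ⟩ : ∃ κ : ℝ, κ = (1 - θ' - η) / (2 * θ') := ⟨_, rfl⟩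
  have hκ0 : 0 < κ := by rw [hκ]; exact div_pos hgap (by positivity)
  have hθκ : θ' * κ = (1 - θ' - η) / 2 := by
    rw [hκ]; field_simp
  obtain ⟨δ₀, hδ₀, c, _hc0, hH⟩ := hHyp κ hκ0
  -- shrink the saving to `δ = min δ₀ 1 ∈ (0, 1]`
  obtain ⟨δ, hδ⟩ : ∃ δ : ℝ, δ = min δ₀ 1 := ⟨_, rfl⟩
  have hδ0 : 0 < δ := by rw [hδ]; exact lt_min hδ₀ one_pos
  have hδ1 : δ ≤ 1 := by rw [hδ]; exact min_le_right _ _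
  have hδδ₀ : δ ≤ δ₀ := by rw [hδ]; exact min_le_left _ _
  have hB := intervalBound_of_hypothesisC hκ0 hδ0 hδδ₀ hH
  obtain ⟨C, hC0, hC⟩ := exists_sum_rho_le_nat
  -- the two exponents of the majorant
  have hE₁1 : θ' + η + θ' * (κ * δ) < 1 := by
    have h1 : θ' + η + θ' * (κ * δ) = θ' + η + δ * ((1 - θ' - η) / 2) := by
      rw [← hθκ]; ring
    rw [h1]
    nlinarith [mul_le_of_le_one_left (by positivity : (0 : ℝ) ≤ (1 - θ' - η) / 2) hδ1]
  have hE₂1 : (1 - δ) + θ' * (1 + κ * δ - (1 - δ)) + η * (1 - (1 - δ)) < 1 := by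
    have h1 : (1 - δ) + θ' * (1 + κ * δ - (1 - δ)) + η * (1 - (1 - δ)) =
        1 - δ * (1 - θ' - η) + δ * (θ' * κ) := by ring
    rw [h1, hθκ]
    nlinarith [mul_pos hδ0 hgap]
  set E : ℝ := max (θ' + η + θ' * (κ * δ))
    ((1 - δ) + θ' * (1 + κ * δ - (1 - δ)) + η * (1 - (1 - δ))) with hE
  have hE1 : E < 1 := max_lt hE₁1 hE₂1
  refine ⟨(1 - E) / 2, by linarith, ?_⟩
  have hmaj := burgess_sum_le_majorant (θ := θ) (θ' := θ') (η := η) (c := max c 1)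
    (s := 1 - δ) (b := κ * δ) (E := E) (by linarith) hθ'0 hη (by linarith) hC0.le hC
    (zero_le_one.trans (le_max_right c 1)) (by linarith) (by linarith) (by positivity)
    (le_max_left _ _) (le_max_right _ _) hB
  have h1 : (fun x : ℕ =>
      ∑ Q ∈ (Finset.range (x + 1)).filter
          (fun Q : ℕ => Q.Prime ∧ (x : ℝ) ^ θ < (Q : ℝ) ∧ (Q : ℝ) ≤ (x : ℝ) ^ θ'),
        ∑ ν ∈ (Finset.range Q).filter (fun ν : ℕ => Q ∣ ν ^ 2 + 1),
          ∑ k ∈ (Finset.Icc 1 x).filter (fun k : ℕ => (k : ℝ) ≤ (x : ℝ) ^ η),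
            ∑ a ∈ (Finset.range k).filter (fun a : ℕ => Q * k ∣ (ν + Q * a) ^ 2 + 1),
              |∑ u ∈ (Finset.range (x + 1)).filter (fun u : ℕ => ν + Q * (a + k * u) ≤ x),
                  (jacobiSym (((ν ^ 2 + 1) / Q + 2 * ν * (a + k * u) : ℕ) : ℤ) Q : ℝ)|)
      =O[Filter.atTop] fun x : ℕ => (x : ℝ) ^ E * (1 + Real.log x) ^ 3 := by
    refine IsBigO.of_bound (8 * max c 1 * C) ?_
    filter_upwards [hmaj] with x hx
    rw [Real.norm_eq_abs, Real.norm_eq_abs, abs_of_nonneg (by positivity)]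
    exact hx.trans (mul_le_mul_of_nonneg_left (le_abs_self _) (by positivity))
  refine h1.trans ?_
  have h2 := rpow_mul_one_add_log_pow_three_isBigO (s := E) (ε := (1 - E) / 2) (by linarith)
  rw [show 1 - (1 - E) / 2 = E + (1 - E) / 2 by ring]
  exact h2

end Summit.Parity.BatemanHorn.Cruxes.SplitBlockJacobi.SplitMassMiddlePrime

end
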